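import Summits.CriticalPhenomena.PercolationContinuityZ3.Theorems.SahiMasterFamilyE3FSplit
import HarnessLib

/-!
# `(1 + μC)·E₃ = 2F + covariance terms`: the exact region where THEOREM F alone gives Kahn's `C₃`

Unit `prim-master-conj` (crux anchor stmt-CriticalPhenomena-4575, helper work), gen 36; memo
`run/shared/lean/prim/prim-l12/prim-master-conj/POINTWISE.md` §37.  Companion of `…SahiMasterFamilyE3FSplit` (gen 30).

Write `a = μA`, `b = μB`, `c = μC`, `Cov(X,Y) = μ(X∩Y) − μX·μY`, `κ₃ = μ(ABC) − a·μ(BC) − b·μ(AC) − c·μ(AB) + 2abc` (joint third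
cumulant of the three indicators), `F(A,B;C) = (1+c)μ(ABC) − c·μ(AB) − μ(AC)μ(BC)` (THEOREM F, `SahiFCombBridge.fIneq_nonneg`:
`F ≥ 0` for increasing events under a product measure) and `E₃ = 2μ(ABC) − a·μ(BC) − b·μ(AC) − c·μ(AB) + abc` (Sahi's cubic
functional; `E₃ ≥ 0` is Kahn's Conjecture 5 / `MasterFamilyNonneg 3`, OPEN).  Ring identities valid for every weight:

* `sahiE_three_ind_eq_cumulant` — **`E₃ = 2κ₃ + a·Cov(B,C) + b·Cov(A,C) + c·Cov(A,B)`**;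
* `fIneq_eq_cumulant` — **`F(A,B;C) = (1+c)κ₃ + a·Cov(B,C) + b·Cov(A,C) + c²·Cov(A,B) − Cov(A,C)·Cov(B,C)`**;
* `one_add_mul_sahiE_three_ind_eq` — eliminating `κ₃` between the two:
  **`(1+c)·E₃ = 2F(A,B;C) + 2·Cov(A,C)·Cov(B,C) + (1−c)·[c·Cov(A,B) − a·Cov(B,C) − b·Cov(A,C)]`**.

Consequences for increasing `A, B, C` under a product measure (THEOREM F + Harris; elementary):
* `one_add_mul_sahiE_three_ind_ge` — **`(1+c)·E₃ ≥ 2·Cov(A,C)·Cov(B,C) − (1−c)·[a·Cov(B,C) + b·Cov(A,C) − c·Cov(A,B)]`**, in particular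
  `sahiE_three_ind_ge_neg_weighted_cov`: **`(1+c)·E₃ ≥ −(1−c)·(a·Cov(B,C) + b·Cov(A,C))`** for every labelling;
* **`sahiE_three_ind_nonneg_of_fRegion`** — `C₃` ON THE EXACT F-REGION: if
  `(1−c)·(a·Cov(B,C) + b·Cov(A,C) − c·Cov(A,B)) ≤ 2·Cov(A,C)·Cov(B,C)` then `E₃(A,B,C) ≥ 0`; the weaker, parameter-light form
  `sahiE_three_ind_nonneg_of_weighted_cov_le`: **if `a·Cov(B,C) + b·Cov(A,C) ≤ c·Cov(A,B)` (one weighted pairwise covariance dominates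
  the other two) then `E₃ ≥ 0`.**
So Sahi's `C₃` can only fail (if at all) in the "triangle regime" where the three weighted covariances `μ(U_i)·Cov(U_j,U_k)` satisfy all
three strict triangle inequalities — e.g. cyclically symmetric, weakly correlated triples.  This region is incomparable with gen 30's
`μA·μB ≤ μ(A∩B∩C)` (`SahiE3FSplit.sahiE_three_ind_nonneg_of_mul_le_inter₃`); on `{0,1}⁴` at `p = ½` the two together leave 1 131 of
776 216 non-degenerate unordered triples (memo §37; e.g. the symmetric triple `(x₀x₁∨x₀x₂, x₀x₁∨x₁x₂, x₀x₂∨x₁x₂)` on three coordinates is in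
neither).  HONEST FRAMING: corollaries of THEOREM F; Kahn's Conjecture 5 / `C₃` remains OPEN. [this work]
-/

noncomputable section

open scoped Classical

namespace Summit.CriticalPhenomena.PercolationContinuityZ3.Theorems

namespace SahiE3FCovariance

open Finset Function
open Literature.Combinatorics.Sahi2008
open Literature.Probability.Percolation.DecisionTree (ind ind_nonneg ind_of_mem ind_of_not_mem)

variable {ι : Type} [Fintype ι]

local notation3 (prettyPrint := false) "μ⟦" q ", " X "⟧" => ex (bernoulliWeight q) (ind X)

/-! ### 1. Ring identities (every weight) -/

/-- **Cumulant form of Sahi's cubic functional**: `E₃(A,B,C) = 2κ₃ + μA·Cov(B,C) + μB·Cov(A,C) + μC·Cov(A,B)`, where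
`κ₃ = μ(ABC) − μA·μ(BC) − μB·μ(AC) − μC·μ(AB) + 2μAμBμC` is the joint third cumulant of the three indicators. [this work] -/
theorem sahiE_three_ind_eq_cumulant (μ : Set ι → ℝ) (A B C : Set (Set ι)) :
    sahiE μ 3 ![ind A, ind B, ind C]
      = 2 * (ex μ (ind (A ∩ B ∩ C)) - ex μ (ind A) * ex μ (ind (B ∩ C)) - ex μ (ind B) * ex μ (ind (A ∩ C))
              - ex μ (ind C) * ex μ (ind (A ∩ B)) + 2 * (ex μ (ind A) * ex μ (ind B) * ex μ (ind C)))
        + ex μ (ind A) * (ex μ (ind (B ∩ C)) - ex μ (ind B) * ex μ (ind C))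
        + ex μ (ind B) * (ex μ (ind (A ∩ C)) - ex μ (ind A) * ex μ (ind C))
        + ex μ (ind C) * (ex μ (ind (A ∩ B)) - ex μ (ind A) * ex μ (ind B)) := by
  rw [sahiE_three, ind_mul_ind_eq_inter, ind_mul_ind_eq_inter, ind_mul_ind_eq_inter, ind_mul_ind_eq_inter]
  ring

/-- **Cumulant form of THEOREM F's functional**:
`F(A,B;C) = (1+μC)κ₃ + μA·Cov(B,C) + μB·Cov(A,C) + (μC)²·Cov(A,B) − Cov(A,C)·Cov(B,C)`. [this work] -/
theorem fIneq_eq_cumulant (μ : Set ι → ℝ) (A B C : Set (Set ι)) :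
    (1 + ex μ (ind C)) * ex μ (ind (A ∩ B ∩ C)) - ex μ (ind C) * ex μ (ind (A ∩ B))
        - ex μ (ind (A ∩ C)) * ex μ (ind (B ∩ C))
      = (1 + ex μ (ind C)) * (ex μ (ind (A ∩ B ∩ C)) - ex μ (ind A) * ex μ (ind (B ∩ C))
            - ex μ (ind B) * ex μ (ind (A ∩ C)) - ex μ (ind C) * ex μ (ind (A ∩ B))
            + 2 * (ex μ (ind A) * ex μ (ind B) * ex μ (ind C)))
        + ex μ (ind A) * (ex μ (ind (B ∩ C)) - ex μ (ind B) * ex μ (ind C))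
        + ex μ (ind B) * (ex μ (ind (A ∩ C)) - ex μ (ind A) * ex μ (ind C))
        + ex μ (ind C) ^ 2 * (ex μ (ind (A ∩ B)) - ex μ (ind A) * ex μ (ind B))
        - (ex μ (ind (A ∩ C)) - ex μ (ind A) * ex μ (ind C)) * (ex μ (ind (B ∩ C)) - ex μ (ind B) * ex μ (ind C)) := by
  ring

/-- **`(1 + μC)·E₃ = 2F + 2·Cov(A,C)·Cov(B,C) + (1 − μC)·[μC·Cov(A,B) − μA·Cov(B,C) − μB·Cov(A,C)]`** — the joint cumulant eliminated
between `E₃` and `F`; a polynomial identity in the seven moments, valid for every weight. [this work] -/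
theorem one_add_mul_sahiE_three_ind_eq (μ : Set ι → ℝ) (A B C : Set (Set ι)) :
    (1 + ex μ (ind C)) * sahiE μ 3 ![ind A, ind B, ind C]
      = 2 * ((1 + ex μ (ind C)) * ex μ (ind (A ∩ B ∩ C)) - ex μ (ind C) * ex μ (ind (A ∩ B))
              - ex μ (ind (A ∩ C)) * ex μ (ind (B ∩ C)))
        + 2 * ((ex μ (ind (A ∩ C)) - ex μ (ind A) * ex μ (ind C))
              * (ex μ (ind (B ∩ C)) - ex μ (ind B) * ex μ (ind C)))
        + (1 - ex μ (ind C)) * (ex μ (ind C) * (ex μ (ind (A ∩ B)) - ex μ (ind A) * ex μ (ind B))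
              - ex μ (ind A) * (ex μ (ind (B ∩ C)) - ex μ (ind B) * ex μ (ind C))
              - ex μ (ind B) * (ex μ (ind (A ∩ C)) - ex μ (ind A) * ex μ (ind C))) := by
  rw [sahiE_three, ind_mul_ind_eq_inter, ind_mul_ind_eq_inter, ind_mul_ind_eq_inter, ind_mul_ind_eq_inter]
  ring

/-! ### 2. Consequences of THEOREM F for increasing events under a product measure -/

/-- **`(1 + μC)·E₃ ≥ 2·Cov(A,C)·Cov(B,C) − (1 − μC)·[μA·Cov(B,C) + μB·Cov(A,C) − μC·Cov(A,B)]`** for increasing `A, B, C`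
(drop `2F ≥ 0`, THEOREM F). [this work] -/
theorem one_add_mul_sahiE_three_ind_ge (p : ι → unitInterval) {A B C : Set (Set ι)}
    (hA : IsUpperSet A) (hB : IsUpperSet B) (hC : IsUpperSet C) :
    2 * ((μ⟦p, A ∩ C⟧ - μ⟦p, A⟧ * μ⟦p, C⟧) * (μ⟦p, B ∩ C⟧ - μ⟦p, B⟧ * μ⟦p, C⟧))
        - (1 - μ⟦p, C⟧) * (μ⟦p, A⟧ * (μ⟦p, B ∩ C⟧ - μ⟦p, B⟧ * μ⟦p, C⟧)
            + μ⟦p, B⟧ * (μ⟦p, A ∩ C⟧ - μ⟦p, A⟧ * μ⟦p, C⟧) - μ⟦p, C⟧ * (μ⟦p, A ∩ B⟧ - μ⟦p, A⟧ * μ⟦p, B⟧))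
      ≤ (1 + μ⟦p, C⟧) * sahiE (bernoulliWeight p) 3 ![ind A, ind B, ind C] := by
  rw [one_add_mul_sahiE_three_ind_eq]
  have hF := SahiFCombBridge.fIneq_nonneg p A B C hA hB hC
  linarith

/-- **KAHN'S CONJECTURE 5 ON THE EXACT F-REGION.**  For increasing `A, B, C` and a product measure `μ_p`: if
`(1 − μC)·(μA·Cov(B,C) + μB·Cov(A,C) − μC·Cov(A,B)) ≤ 2·Cov(A,C)·Cov(B,C)`, then `E₃(μ_p; A, B, C) ≥ 0`.  (This is exactly the set
of parameters where THEOREM F alone certifies `C₃` through `one_add_mul_sahiE_three_ind_eq`.) [this work] -/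
theorem sahiE_three_ind_nonneg_of_fRegion (p : ι → unitInterval) {A B C : Set (Set ι)}
    (hA : IsUpperSet A) (hB : IsUpperSet B) (hC : IsUpperSet C)
    (hreg : (1 - μ⟦p, C⟧) * (μ⟦p, A⟧ * (μ⟦p, B ∩ C⟧ - μ⟦p, B⟧ * μ⟦p, C⟧)
              + μ⟦p, B⟧ * (μ⟦p, A ∩ C⟧ - μ⟦p, A⟧ * μ⟦p, C⟧) - μ⟦p, C⟧ * (μ⟦p, A ∩ B⟧ - μ⟦p, A⟧ * μ⟦p, B⟧))
        ≤ 2 * ((μ⟦p, A ∩ C⟧ - μ⟦p, A⟧ * μ⟦p, C⟧) * (μ⟦p, B ∩ C⟧ - μ⟦p, B⟧ * μ⟦p, C⟧))) :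
    0 ≤ sahiE (bernoulliWeight p) 3 ![ind A, ind B, ind C] := by
  have h := one_add_mul_sahiE_three_ind_ge p hA hB hC
  have hc0 : 0 ≤ μ⟦p, C⟧ := ex_nonneg (isFKGMeasure_bernoulliWeight p).nonneg fun ω => ind_nonneg C ω
  have hpos : 0 < 1 + μ⟦p, C⟧ := by linarith
  have hprod : 0 ≤ (1 + μ⟦p, C⟧) * sahiE (bernoulliWeight p) 3 ![ind A, ind B, ind C] := by linarith
  exact nonneg_of_mul_nonneg_right hprod hpos

/-- **`C₃` when one weighted pairwise covariance dominates the other two**: for increasing `A, B, C` under a product measure,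
`μA·Cov(B,C) + μB·Cov(A,C) ≤ μC·Cov(A,B)` implies `E₃(A,B,C) ≥ 0` (the F-region condition with its nonnegative right-hand side
`2·Cov(A,C)·Cov(B,C)` — Harris — discarded). [this work] -/
theorem sahiE_three_ind_nonneg_of_weighted_cov_le (p : ι → unitInterval) {A B C : Set (Set ι)}
    (hA : IsUpperSet A) (hB : IsUpperSet B) (hC : IsUpperSet C)
    (hdom : μ⟦p, A⟧ * (μ⟦p, B ∩ C⟧ - μ⟦p, B⟧ * μ⟦p, C⟧) + μ⟦p, B⟧ * (μ⟦p, A ∩ C⟧ - μ⟦p, A⟧ * μ⟦p, C⟧)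
        ≤ μ⟦p, C⟧ * (μ⟦p, A ∩ B⟧ - μ⟦p, A⟧ * μ⟦p, B⟧)) :
    0 ≤ sahiE (bernoulliWeight p) 3 ![ind A, ind B, ind C] := by
  refine sahiE_three_ind_nonneg_of_fRegion p hA hB hC ?_
  have hC1 : μ⟦p, C⟧ ≤ 1 := SahiE3FSplit.ex_ind_le_one p C
  have hAC : 0 ≤ μ⟦p, A ∩ C⟧ - μ⟦p, A⟧ * μ⟦p, C⟧ := sub_nonneg.2 (harris_ex_ind p hA hC)
  have hBC : 0 ≤ μ⟦p, B ∩ C⟧ - μ⟦p, B⟧ * μ⟦p, C⟧ := sub_nonneg.2 (harris_ex_ind p hB hC)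
  have h1 : (1 - μ⟦p, C⟧) * (μ⟦p, A⟧ * (μ⟦p, B ∩ C⟧ - μ⟦p, B⟧ * μ⟦p, C⟧)
              + μ⟦p, B⟧ * (μ⟦p, A ∩ C⟧ - μ⟦p, A⟧ * μ⟦p, C⟧) - μ⟦p, C⟧ * (μ⟦p, A ∩ B⟧ - μ⟦p, A⟧ * μ⟦p, B⟧)) ≤ 0 :=
    mul_nonpos_of_nonneg_of_nonpos (sub_nonneg.2 hC1) (by linarith)
  have h2 : 0 ≤ 2 * ((μ⟦p, A ∩ C⟧ - μ⟦p, A⟧ * μ⟦p, C⟧) * (μ⟦p, B ∩ C⟧ - μ⟦p, B⟧ * μ⟦p, C⟧)) :=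
    mul_nonneg zero_le_two (mul_nonneg hAC hBC)
  linarith

/-- **A quantitative lower bound for every labelling**: for increasing `A, B, C` under a product measure,
`E₃(A,B,C) ≥ −((1 − μC)/(1 + μC))·(μA·Cov(B,C) + μB·Cov(A,C))`, stated without division as
`(1 + μC)·E₃ ≥ −(1 − μC)·(μA·Cov(B,C) + μB·Cov(A,C))`. [this work] -/
theorem sahiE_three_ind_ge_neg_weighted_cov (p : ι → unitInterval) {A B C : Set (Set ι)}
    (hA : IsUpperSet A) (hB : IsUpperSet B) (hC : IsUpperSet C) :
    -((1 - μ⟦p, C⟧) * (μ⟦p, A⟧ * (μ⟦p, B ∩ C⟧ - μ⟦p, B⟧ * μ⟦p, C⟧)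
        + μ⟦p, B⟧ * (μ⟦p, A ∩ C⟧ - μ⟦p, A⟧ * μ⟦p, C⟧)))
      ≤ (1 + μ⟦p, C⟧) * sahiE (bernoulliWeight p) 3 ![ind A, ind B, ind C] := by
  have h := one_add_mul_sahiE_three_ind_ge p hA hB hC
  have hC1 : μ⟦p, C⟧ ≤ 1 := SahiE3FSplit.ex_ind_le_one p C
  have hc0 : 0 ≤ μ⟦p, C⟧ := ex_nonneg (isFKGMeasure_bernoulliWeight p).nonneg fun ω => ind_nonneg C ω
  have hAC : 0 ≤ μ⟦p, A ∩ C⟧ - μ⟦p, A⟧ * μ⟦p, C⟧ := sub_nonneg.2 (harris_ex_ind p hA hC)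
  have hBC : 0 ≤ μ⟦p, B ∩ C⟧ - μ⟦p, B⟧ * μ⟦p, C⟧ := sub_nonneg.2 (harris_ex_ind p hB hC)
  have hAB : 0 ≤ μ⟦p, A ∩ B⟧ - μ⟦p, A⟧ * μ⟦p, B⟧ := sub_nonneg.2 (harris_ex_ind p hA hB)
  have h2 : 0 ≤ (μ⟦p, A ∩ C⟧ - μ⟦p, A⟧ * μ⟦p, C⟧) * (μ⟦p, B ∩ C⟧ - μ⟦p, B⟧ * μ⟦p, C⟧) := mul_nonneg hAC hBC
  have h3 : 0 ≤ (1 - μ⟦p, C⟧) * (μ⟦p, C⟧ * (μ⟦p, A ∩ B⟧ - μ⟦p, A⟧ * μ⟦p, B⟧)) :=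
    mul_nonneg (sub_nonneg.2 hC1) (mul_nonneg hc0 hAB)
  nlinarith [h, h2, h3]

/-! ### 3. A quantitative form: `E₃ ≥ Cov(A,B)·Cov(A,C)·Cov(B,C)` on the dominant-covariance region

The cubic-stability reading `E₃ ≥ κ·Cov(A,B)Cov(A,C)Cov(B,C)` can hold at best with `κ = 1`: for the triple
`(x₀∨x₁, x₀∨x₂, x₁∨x₂)` at `p = (π,π,π)` one has `E₃ = π³(1−π)³` and every pairwise covariance `= π(1−π)³`, so the ratio is `(1−π)⁻⁶ → 1`
(memo POINTWISE §37.5, correcting an earlier census reading `κ ≈ 12.9`).  On the region of `sahiE_three_ind_nonneg_of_weighted_cov_le` the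
constant `1` is a THEOREM (again only THEOREM F + Harris). -/

/-- **`E₃ ≥ Cov(A,C)·Cov(B,C)` when `μA·Cov(B,C) + μB·Cov(A,C) ≤ μC·Cov(A,B)`** (increasing events, product measure). [this work] -/
theorem sahiE_three_ind_ge_cov_mul_cov_of_weighted_cov_le (p : ι → unitInterval) {A B C : Set (Set ι)}
    (hA : IsUpperSet A) (hB : IsUpperSet B) (hC : IsUpperSet C)
    (hdom : μ⟦p, A⟧ * (μ⟦p, B ∩ C⟧ - μ⟦p, B⟧ * μ⟦p, C⟧) + μ⟦p, B⟧ * (μ⟦p, A ∩ C⟧ - μ⟦p, A⟧ * μ⟦p, C⟧)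
        ≤ μ⟦p, C⟧ * (μ⟦p, A ∩ B⟧ - μ⟦p, A⟧ * μ⟦p, B⟧)) :
    (μ⟦p, A ∩ C⟧ - μ⟦p, A⟧ * μ⟦p, C⟧) * (μ⟦p, B ∩ C⟧ - μ⟦p, B⟧ * μ⟦p, C⟧)
      ≤ sahiE (bernoulliWeight p) 3 ![ind A, ind B, ind C] := by
  have h := one_add_mul_sahiE_three_ind_ge p hA hB hC
  have hC1 : μ⟦p, C⟧ ≤ 1 := SahiE3FSplit.ex_ind_le_one p C
  have hc0 : 0 ≤ μ⟦p, C⟧ := ex_nonneg (isFKGMeasure_bernoulliWeight p).nonneg fun ω => ind_nonneg C ω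
  have hAC : 0 ≤ μ⟦p, A ∩ C⟧ - μ⟦p, A⟧ * μ⟦p, C⟧ := sub_nonneg.2 (harris_ex_ind p hA hC)
  have hBC : 0 ≤ μ⟦p, B ∩ C⟧ - μ⟦p, B⟧ * μ⟦p, C⟧ := sub_nonneg.2 (harris_ex_ind p hB hC)
  have h1 : (1 - μ⟦p, C⟧) * (μ⟦p, A⟧ * (μ⟦p, B ∩ C⟧ - μ⟦p, B⟧ * μ⟦p, C⟧)
              + μ⟦p, B⟧ * (μ⟦p, A ∩ C⟧ - μ⟦p, A⟧ * μ⟦p, C⟧) - μ⟦p, C⟧ * (μ⟦p, A ∩ B⟧ - μ⟦p, A⟧ * μ⟦p, B⟧)) ≤ 0 :=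
    mul_nonpos_of_nonneg_of_nonpos (sub_nonneg.2 hC1) (by linarith)
  have h2 : 0 ≤ (μ⟦p, A ∩ C⟧ - μ⟦p, A⟧ * μ⟦p, C⟧) * (μ⟦p, B ∩ C⟧ - μ⟦p, B⟧ * μ⟦p, C⟧) := mul_nonneg hAC hBC
  nlinarith [h, h1, h2, hc0, hC1]

/-- **`E₃ ≥ Cov(A,B)·Cov(A,C)·Cov(B,C)` (the sharp cubic-stability constant `1`) when `μA·Cov(B,C) + μB·Cov(A,C) ≤ μC·Cov(A,B)`**
(increasing events, product measure): from the previous bound and `Cov(A,B) ≤ 1`. [this work] -/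
theorem sahiE_three_ind_ge_prod_cov_of_weighted_cov_le (p : ι → unitInterval) {A B C : Set (Set ι)}
    (hA : IsUpperSet A) (hB : IsUpperSet B) (hC : IsUpperSet C)
    (hdom : μ⟦p, A⟧ * (μ⟦p, B ∩ C⟧ - μ⟦p, B⟧ * μ⟦p, C⟧) + μ⟦p, B⟧ * (μ⟦p, A ∩ C⟧ - μ⟦p, A⟧ * μ⟦p, C⟧)
        ≤ μ⟦p, C⟧ * (μ⟦p, A ∩ B⟧ - μ⟦p, A⟧ * μ⟦p, B⟧)) :
    (μ⟦p, A ∩ B⟧ - μ⟦p, A⟧ * μ⟦p, B⟧) * (μ⟦p, A ∩ C⟧ - μ⟦p, A⟧ * μ⟦p, C⟧)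
        * (μ⟦p, B ∩ C⟧ - μ⟦p, B⟧ * μ⟦p, C⟧)
      ≤ sahiE (bernoulliWeight p) 3 ![ind A, ind B, ind C] := by
  have h := sahiE_three_ind_ge_cov_mul_cov_of_weighted_cov_le p hA hB hC hdom
  have hAB : 0 ≤ μ⟦p, A ∩ B⟧ - μ⟦p, A⟧ * μ⟦p, B⟧ := sub_nonneg.2 (harris_ex_ind p hA hB)
  have hAB1 : μ⟦p, A ∩ B⟧ - μ⟦p, A⟧ * μ⟦p, B⟧ ≤ 1 := by
    have h1 : μ⟦p, A ∩ B⟧ ≤ 1 := SahiE3FSplit.ex_ind_le_one p (A ∩ B)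
    have ha : 0 ≤ μ⟦p, A⟧ := ex_nonneg (isFKGMeasure_bernoulliWeight p).nonneg fun ω => ind_nonneg A ω
    have hb : 0 ≤ μ⟦p, B⟧ := ex_nonneg (isFKGMeasure_bernoulliWeight p).nonneg fun ω => ind_nonneg B ω
    nlinarith [mul_nonneg ha hb]
  have hAC : 0 ≤ μ⟦p, A ∩ C⟧ - μ⟦p, A⟧ * μ⟦p, C⟧ := sub_nonneg.2 (harris_ex_ind p hA hC)
  have hBC : 0 ≤ μ⟦p, B ∩ C⟧ - μ⟦p, B⟧ * μ⟦p, C⟧ := sub_nonneg.2 (harris_ex_ind p hB hC)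
  have h2 : 0 ≤ (μ⟦p, A ∩ C⟧ - μ⟦p, A⟧ * μ⟦p, C⟧) * (μ⟦p, B ∩ C⟧ - μ⟦p, B⟧ * μ⟦p, C⟧) := mul_nonneg hAC hBC
  calc (μ⟦p, A ∩ B⟧ - μ⟦p, A⟧ * μ⟦p, B⟧) * (μ⟦p, A ∩ C⟧ - μ⟦p, A⟧ * μ⟦p, C⟧)
          * (μ⟦p, B ∩ C⟧ - μ⟦p, B⟧ * μ⟦p, C⟧)
        = (μ⟦p, A ∩ B⟧ - μ⟦p, A⟧ * μ⟦p, B⟧)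
          * ((μ⟦p, A ∩ C⟧ - μ⟦p, A⟧ * μ⟦p, C⟧) * (μ⟦p, B ∩ C⟧ - μ⟦p, B⟧ * μ⟦p, C⟧)) := by ring
    _ ≤ 1 * ((μ⟦p, A ∩ C⟧ - μ⟦p, A⟧ * μ⟦p, C⟧) * (μ⟦p, B ∩ C⟧ - μ⟦p, B⟧ * μ⟦p, C⟧)) :=
        mul_le_mul_of_nonneg_right hAB1 h2
    _ ≤ sahiE (bernoulliWeight p) 3 ![ind A, ind B, ind C] := by rw [one_mul]; exact h

end SahiE3FCovariance

end Summit.CriticalPhenomena.PercolationContinuityZ3.Theorems
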